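import Summits.BirchSwinnertonDyer.BirchSwinnertonDyer.Theorems.TameQuarticSolventSolventPairLowerBoundSolventField
import Literature.NumberTheory.QuadraticFields.DiscriminantOfSqrt
import Literature.NumberTheory.EllipticCurves.HeegnerPoints
import HarnessLib

set_option linter.dupNamespace false
set_option autoImplicit false

/-!
# Crux `PrintCf2.SplitBadTwoRankOneOfFacts` (stmt-BirchSwinnertonDyer-20368): the HABITAT FIELD `M = K₀(√e)`, `e ∈ {−1, 2, −2}`,
# of the ideator line `ltyz_unramified_habitat` EXISTS AS A TYPE — its support stub S4 `stub_habitatField`, proved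

Cell `bsd-print-cf2`, LEAD seat `bsd-line-cf2-p1` g10 (`--supports stmt-BirchSwinnertonDyer-20368`). HONEST FRAMING: elementary
bookkeeping on quadratic fields; nothing about BSD, `L`-functions or Selmer groups is asserted; BSD is not proved by any of this; no
summit statement is proved by this seat. The ideator line `Cruxes/SplitBadTwoRankOneOfFacts/Lines/ltyz_unramified_habitat.lean`
(bsd-idea-7 g9; NOT the skeleton of record — that is road α v8, `Lines/rubin_value_two_lead_v8.lean`) runs Li–Tian–Yan–Zhu's announced
abelian-base `2`-adic BSD over the habitat `M = K₀(√e)`, `K₀ = ℚ(√−7)` the CM field of the twists of `X₀(49)`, `e ∈ {−1, 2, −2}` according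
to `d mod 8`; its composition needs `M` as a number-field `Type` over `K₀` with a square-root generator `θ`, `θ² = e`, `θ ∉ K₀` (stub S4).
This file proves that statement VERBATIM (`stub_habitatField`), so a future registration of the habitat line starts with four stubs.

* `not_isSquare_of_discr_eq_neg_seven` — in a quadratic field of discriminant `−7` none of `−1, 2, −2` is a square: a square root `θ`
  would generate the field (`e` is not a rational square), and then `d_K = 4e ∈ {−4, 8, −8}` by the tree's
  `Quadratic.discr_eq_four_mul_of_sq_eq_intCast` (Marcus Ch. 2 Thm. 1: `θ² = m`, `m ≡ 2, 3 (mod 4)` squarefree ⟹ `d_K = 4m`).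
* `stub_habitatField` — the S4 signature of `Lines/ltyz_unramified_habitat.lean`, character for character: the relative quadratic
  extension is the tree's `SolventPairLowerBound.exists_relQuadratic_sq_eq` (Mathlib `QuadraticAlgebra K e 0`).

References: [Marcus2018] D. A. Marcus, *Number Fields*, 2nd ed., Ch. 2 Thm. 1 (discriminant of `ℚ(√m)`); [Cox2013] D. A. Cox,
*Primes of the form x² + ny²*, 2nd ed., p. 119 (eq. (5.12)); [LiTianYanZhu2025] §1.3 p. 3 (the abelian base `F₀`).
-/

noncomputable section

open scoped Classical NumberField
open NumberField Module
open Literature.NumberTheory.EllipticCurves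
open Literature.NumberTheory.QuadraticFields

namespace Summit.BirchSwinnertonDyer.BirchSwinnertonDyer.Theorems.PrintCf2.Habitat

/-- **In a quadratic field of discriminant `−7`, none of `−1, 2, −2` is a square.** If `θ² = e` with `θ ∈ K`, `e ∈ {−1, 2, −2}`
(`e ≡ 3, 2, 2 (mod 4)`, squarefree), then `d_K = 4e ∈ {−4, 8, −8}` (Marcus Ch. 2 Thm. 1, tree
`Quadratic.discr_eq_four_mul_of_sq_eq_intCast`), contradicting `d_K = −7`. [cite: Marcus2018, Ch. 2 Thm. 1] -/
theorem not_isSquare_of_discr_eq_neg_seven {K : Type*} [Field K] [NumberField K] (h2 : finrank ℚ K = 2)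
    (hdK : NumberField.discr K = -7) {e : ℚ} (he : e = -1 ∨ e = 2 ∨ e = -2) :
    ¬ IsSquare (algebraMap ℚ K e) := by
  rintro ⟨θ, hθ⟩
  -- `e` is the integer `m ∈ {−1, 2, −2}`
  obtain ⟨m, rfl, hm4, hsf, hm7⟩ : ∃ m : ℤ, e = (m : ℚ) ∧ (m % 4 = 2 ∨ m % 4 = 3) ∧ Squarefree m ∧ 4 * m ≠ -7 := by
    rcases he with rfl | rfl | rfl
    · exact ⟨-1, by norm_num, Or.inr (by decide), by rw [← Int.squarefree_natAbs]; exact squarefree_one, by decide⟩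
    · exact ⟨2, by norm_num, Or.inl (by decide), Int.prime_two.squarefree, by decide⟩
    · exact ⟨-2, by norm_num, Or.inl (by decide), by rw [← Int.squarefree_natAbs]; exact Nat.prime_two.squarefree,
        by decide⟩
  have hsq : θ ^ 2 = (m : K) := by rw [sq, ← hθ, map_intCast]
  exact hm7 ((Quadratic.discr_eq_four_mul_of_sq_eq_intCast h2 hsq hm4 hsf).symm.trans hdK)

/-- **S4 of the line `ltyz_unramified_habitat` — THE HABITAT FIELD EXISTS AS A TYPE** (signature VERBATIM
`Cruxes/SplitBadTwoRankOneOfFacts/Lines/ltyz_unramified_habitat.lean`, `stub_habitatField`): for an imaginary quadratic `K` with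
`d_K = −7` and `e ∈ {−1, 2, −2}` there is a number field `M ⊇ K` with `[M : K] = 2` and `θ ∈ M`, `θ² = e`, `θ ∉ K` — `e` is not a square
in `K` (`not_isSquare_of_discr_eq_neg_seven`) and `M = K(√e)` is the tree's relative quadratic extension
(`SolventPairLowerBound.exists_relQuadratic_sq_eq`, Mathlib `QuadraticAlgebra`). [cite: Marcus2018, Ch. 2 Thm. 1] [cite: Cox2013, p. 119] -/
theorem stub_habitatField :
    ∀ (K : Type) [Field K] [NumberField K], IsImaginaryQuadratic K → NumberField.discr K = -7 →
    ∀ (e : ℚ), (e = -1 ∨ e = 2 ∨ e = -2) →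
    ∃ (M : Type) (_ : Field M) (_ : NumberField M) (_ : Algebra K M) (θ : M),
      Module.finrank K M = 2 ∧ θ ^ 2 = algebraMap K M (algebraMap ℚ K e) ∧ θ ∉ Set.range (algebraMap K M) := by
  intro K _ _ hK hdK e he
  exact SolventPairLowerBound.exists_relQuadratic_sq_eq (not_isSquare_of_discr_eq_neg_seven hK.1 hdK he)

/-- **Instance form**: for `[Field K] [NumberField K]` imaginary quadratic of discriminant `−7` and `e ∈ {−1, 2, −2}`, the habitat
`K(√e)` with its generator. (Same statement with instance binders, for use under `obtain`.) [cite: Marcus2018, Ch. 2 Thm. 1] -/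
theorem exists_habitatField {K : Type} [Field K] [NumberField K] (hK : IsImaginaryQuadratic K)
    (hdK : NumberField.discr K = -7) {e : ℚ} (he : e = -1 ∨ e = 2 ∨ e = -2) :
    ∃ (M : Type) (_ : Field M) (_ : NumberField M) (_ : Algebra K M) (θ : M),
      Module.finrank K M = 2 ∧ θ ^ 2 = algebraMap K M (algebraMap ℚ K e) ∧ θ ∉ Set.range (algebraMap K M) :=
  stub_habitatField K hK hdK e he

end Summit.BirchSwinnertonDyer.BirchSwinnertonDyer.Theorems.PrintCf2.Habitat

end
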